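import Mathlib
import HarnessLib

/-!
# RigidMotionDoor — crux `EuclidAccumulation` (stmt-NavierStokesRegularity-27902, LINE g5-3 «stabilisation», ns-idea-6 g5),
# stub `stub_subspaceStabilisation` (S, pure linear algebra)

A family of submodules of a finite-dimensional real vector space indexed by the negative times and non-decreasing in time is
dominated from below by one of its members: some `V s₀`, `s₀ < 0`, lies inside every `V s`, `s < 0` (take `s₀` where the
ℕ-valued monotone function `finrank ∘ V` attains its minimum over `s < 0`; below `s₀` the inclusion `V s ≤ V s₀` with equal
finite rank is an equality, `Submodule.eq_of_le_of_finrank_eq`).  Statement = the skeleton's `StubSubspaceStabilisation`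
(`Cruxes/EuclidAccumulation/…` sha16 b01e09427edbe9e2) UNFOLDED (a Theorems file cannot import the Cruxes workfile).

Prover ns-imp-p1 g4 (prepared while FREE; lands only on the director's key per DIRECTOR-NS #224 (1)(c)).  WHAT THIS IS NOT:
linear algebra only; nothing about Navier–Stokes; item 27902 / the door / NS regularity NOT proved.
-/

set_option linter.dupNamespace false

namespace Summit.NavierStokesRegularity.NavierStokesRegularity.Theorems

/-- **Stub `stub_subspaceStabilisation` of crux `EuclidAccumulation` (unfolded statement).** -/
theorem rigidMotionDoor_stub_subspaceStabilisation :
    ∀ (W : Type) [AddCommGroup W] [Module ℝ W] [FiniteDimensional ℝ W] (V : ℝ → Submodule ℝ W),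
      (∀ s₁ s₂ : ℝ, s₁ ≤ s₂ → s₂ < 0 → V s₁ ≤ V s₂) → ∃ s₀ : ℝ, s₀ < 0 ∧ ∀ s < 0, V s₀ ≤ V s := by
  intro W _ _ _ V hmono
  classical
  -- the set of ranks attained at negative times, and its minimum
  have hne : ∃ n : ℕ, ∃ s : ℝ, s < 0 ∧ Module.finrank ℝ (V s) = n := ⟨_, -1, by norm_num, rfl⟩
  obtain ⟨s₀, hs₀, hrank⟩ := Nat.find_spec hne
  have hmin : ∀ s : ℝ, s < 0 → Nat.find hne ≤ Module.finrank ℝ (V s) :=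
    fun s hs => Nat.find_min' hne ⟨s, hs, rfl⟩
  refine ⟨s₀, hs₀, fun s hs => ?_⟩
  rcases le_or_gt s₀ s with h | h
  · exact hmono s₀ s h hs
  · -- below `s₀`: `V s ≤ V s₀` with `finrank (V s) ≥ finrank (V s₀)`, hence equality
    have hle : V s ≤ V s₀ := hmono s s₀ h.le hs₀
    have hfin : Module.finrank ℝ (V s₀) ≤ Module.finrank ℝ (V s) := by
      rw [hrank]; exact hmin s hs
    have heq : V s = V s₀ := Submodule.eq_of_le_of_finrank_le hle hfin
    rw [heq]

end Summit.NavierStokesRegularity.NavierStokesRegularity.Theorems
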